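import Mathlib.Algebra.BigOperators.Fin
import Mathlib.Algebra.BigOperators.Group.Finset.Piecewise
import Mathlib.Data.Fintype.BigOperators
import Mathlib.Algebra.Order.BigOperators.Group.Finset
import Mathlib.GroupTheory.Index
import Mathlib.GroupTheory.OrderOfElement
import Mathlib.Tactic.Linarith
import Mathlib.Tactic.Ring
import HarnessLib

/-!
# Class counts of a digit-box coset table

Topic `Computability/Cryptography` (combinatorics of period finding over `ℤ^T`); theorem-only file, no named facts.

This is brick 8 of the class-table law of the crux `LinnikCubicClassGroups.PureCubicClassGroupFBQP`
(Hallgren's class-group stage, abstractly), consumed by the unit-law wrapper: the register `[0, M^T)` is read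
through its base-`M` digit vectors `d(E) = (E / M^t mod M)_t ∈ [0, M)^T ⊂ ℤ^T`, and a labelling `cls` of the
register is a CLASS TABLE for a finite-index subgroup `Λ ≤ ℤ^T` when `cls E = cls E' ↔ d(E) − d(E') ∈ Λ`.
If the index `h = [ℤ^T : Λ]` is at most `M`, then

* `card_image_cls_eq_index` — there are EXACTLY `h` classes (every coset of `Λ` meets the box, because
  `h ℤ^T ⊆ Λ` and reducing a vector coordinatewise modulo `h` lands in `[0, h)^T ⊆ [0, M)^T`);
* `card_class_le_card_class_add` — any two classes differ in size by at most `h T M^(T-1)` (translate one class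
  by a small coset representative `w ∈ [0, h)^T`; the translation is injective into the other class except on
  the points with some digit `≥ M − w_t`, and for each `t` these number `w_t M^(T-1) < h M^(T-1)`).

Both are first proved on the box `Fin T → Fin M` (`…_box`) and transported to the register through
`finFunctionFinEquiv`. Pure finite combinatorics; no analysis and no number theory here.
-/

namespace Literature.Computability.Cryptography

namespace PeriodFinding

open Finset

/-! ### Counting box points with one constrained coordinate -/

/-- In `[0, M)`, at most `c` residues `x` have `M ≤ x + c`. [folklore] -/
theorem card_filter_le_val_add (M c : ℕ) :
    (univ.filter (fun x : Fin M => M ≤ (x : ℕ) + c)).card ≤ c := by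
  calc (univ.filter (fun x : Fin M => M ≤ (x : ℕ) + c)).card
      ≤ (range c).card := card_le_card_of_injOn (fun x : Fin M => (x : ℕ) - (M - c)) ?_ ?_
    _ = c := card_range c
  · intro x hx
    rw [mem_coe, mem_filter] at hx
    rw [mem_coe, mem_range]
    have := x.isLt
    dsimp only
    omega
  · intro x hx y hy hxy
    rw [mem_coe, mem_filter] at hx hy
    have := x.isLt
    have := y.isLt
    apply Fin.ext
    dsimp only at hxy
    omega

/-- In the box `[0, M)^T`, at most `c M^(T-1)` points `f` have `M ≤ f t + c` at a fixed coordinate `t`. [folklore] -/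
theorem card_filter_le_apply_add (T M c : ℕ) (t : Fin T) :
    (univ.filter (fun f : Fin T → Fin M => M ≤ (f t : ℕ) + c)).card ≤ c * M ^ (T - 1) := by
  classical
  set S : Finset (Fin M) := univ.filter (fun x : Fin M => M ≤ (x : ℕ) + c) with hS
  have hX : univ.filter (fun f : Fin T → Fin M => M ≤ (f t : ℕ) + c) =
      Fintype.piFinset (fun i : Fin T => if i = t then S else univ) := by
    ext f
    simp only [mem_filter, mem_univ, true_and, Fintype.mem_piFinset]
    constructor
    · intro hf i
      by_cases hi : i = t
      · subst hi
        simp [hS, hf]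
      · simp [hi]
    · intro hf
      simpa [hS] using hf t
  have hrest : ∏ i ∈ ({t} : Finset (Fin T))ᶜ, (if i = t then S else univ).card = M ^ (T - 1) := by
    rw [prod_congr rfl (g := fun _ => M), prod_const, card_compl, Fintype.card_fin, card_singleton]
    intro i hi
    rw [mem_compl, mem_singleton] at hi
    rw [if_neg hi, card_univ, Fintype.card_fin]
  rw [hX, Fintype.card_piFinset, Fintype.prod_eq_mul_prod_compl t, if_pos rfl, hrest]
  exact Nat.mul_le_mul_right _ (card_filter_le_val_add M c)

/-! ### Small coset representatives -/

/-- **Small coset representatives.** For a finite-index `Λ ≤ ℤ^T` with `[ℤ^T : Λ] ≤ M`, every `v ∈ ℤ^T` is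
congruent modulo `Λ` to a box vector `w ∈ [0, M)^T` all of whose entries are `< [ℤ^T : Λ]`: reduce each entry
modulo the index, using `[ℤ^T : Λ] • ℤ^T ⊆ Λ`. [folklore] -/
theorem exists_small_repr {T M : ℕ} (Λ : AddSubgroup (Fin T → ℤ)) [Λ.FiniteIndex] (hMh : Λ.index ≤ M)
    (v : Fin T → ℤ) :
    ∃ w : Fin T → Fin M, (∀ t, (w t : ℕ) < Λ.index) ∧ (fun t => ((w t : ℕ) : ℤ)) - v ∈ Λ := by
  have h0 : Λ.index ≠ 0 := AddSubgroup.FiniteIndex.index_ne_zero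
  have hlt : ∀ t, Int.natMod (v t) Λ.index < Λ.index := fun t => Int.natMod_lt h0
  refine ⟨fun t => ⟨Int.natMod (v t) Λ.index, (hlt t).trans_le hMh⟩, hlt, ?_⟩
  convert AddSubgroup.nsmul_index_mem Λ (fun t => -(v t / Λ.index)) using 1
  funext t
  simp only [Pi.sub_apply, Pi.smul_apply, nsmul_eq_mul, Int.natMod,
    Int.toNat_of_nonneg (Int.emod_nonneg _ (by exact_mod_cast h0 : (Λ.index : ℤ) ≠ 0))]
  have := Int.emod_add_mul_ediv (v t) Λ.index
  linarith

/-! ### The box versions -/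

/-- **Classes are cosets (box version).** If `cls` labels the box `[0, M)^T` so that two points get the same label
iff their difference lies in `Λ`, and `[ℤ^T : Λ] ≤ M`, then there are exactly `[ℤ^T : Λ]` labels: the label
factors injectively through `ℤ^T/Λ`, onto by `exists_small_repr`. [folklore] -/
theorem card_image_cls_eq_index_box {T M : ℕ} (Λ : AddSubgroup (Fin T → ℤ)) [Λ.FiniteIndex]
    (hMh : Λ.index ≤ M) (cls : (Fin T → Fin M) → ℕ)
    (hcls : ∀ f f', cls f = cls f' ↔ (fun t => ((f t : ℕ) : ℤ) - ((f' t : ℕ) : ℤ)) ∈ Λ) :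
    (univ.image cls).card = Λ.index := by
  classical
  letI := Λ.fintypeQuotientOfFiniteIndex
  have hiff : ∀ f f' : Fin T → Fin M, cls f = cls f' ↔
      ((fun t => ((f t : ℕ) : ℤ) : Fin T → ℤ) : (Fin T → ℤ) ⧸ Λ) = (fun t => ((f' t : ℕ) : ℤ) : Fin T → ℤ) := by
    intro f f'
    rw [hcls, QuotientAddGroup.eq_iff_sub_mem]
    exact Iff.rfl
  choose w hw hwv using fun q : (Fin T → ℤ) ⧸ Λ => exists_small_repr Λ hMh q.out
  have hφw : ∀ q : (Fin T → ℤ) ⧸ Λ, ((fun t => ((w q t : ℕ) : ℤ) : Fin T → ℤ) : (Fin T → ℤ) ⧸ Λ) = q :=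
    fun q => (QuotientAddGroup.eq_iff_sub_mem.2 (hwv q)).trans (QuotientAddGroup.out_eq' q)
  have hcl : ∀ f, cls f = cls (w ((fun t => ((f t : ℕ) : ℤ) : Fin T → ℤ) : (Fin T → ℤ) ⧸ Λ)) :=
    fun f => (hiff f _).2 (hφw _).symm
  have hinj : Function.Injective (fun q : (Fin T → ℤ) ⧸ Λ => cls (w q)) := by
    intro q q' hqq
    have h := (hiff _ _).1 hqq
    rwa [hφw, hφw] at h
  have himage : univ.image cls = univ.image (fun q : (Fin T → ℤ) ⧸ Λ => cls (w q)) := by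
    ext g
    simp only [mem_image, mem_univ, true_and]
    constructor
    · rintro ⟨f, rfl⟩
      exact ⟨_, (hcl f).symm⟩
    · rintro ⟨q, rfl⟩
      exact ⟨w q, rfl⟩
  rw [himage, card_image_of_injective _ hinj, card_univ, AddSubgroup.index_eq_card, Nat.card_eq_fintype_card]

/-- **Two classes differ in size by at most `[ℤ^T : Λ] T M^(T-1)` (box version).** Translate the class of `g`
by a small representative `w ∈ [0, [ℤ^T : Λ])^T` of the coset difference: this is injective into the class of
`g'` on the points with all `f t + w t < M`; the others have some coordinate with `M ≤ f t + w t`, at most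
`∑_t w_t M^(T-1) ≤ [ℤ^T : Λ] T M^(T-1)` of them (`card_filter_le_apply_add`). [folklore] -/
theorem card_class_le_card_class_add_box {T M : ℕ} (Λ : AddSubgroup (Fin T → ℤ)) [Λ.FiniteIndex]
    (hMh : Λ.index ≤ M) (cls : (Fin T → Fin M) → ℕ)
    (hcls : ∀ f f', cls f = cls f' ↔ (fun t => ((f t : ℕ) : ℤ) - ((f' t : ℕ) : ℤ)) ∈ Λ)
    (g g' : ℕ) (hg' : g' ∈ univ.image cls) :
    (univ.filter (fun f => cls f = g)).card ≤
      (univ.filter (fun f => cls f = g')).card + Λ.index * T * M ^ (T - 1) := by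
  classical
  have hM : 0 < M := (Nat.pos_of_ne_zero AddSubgroup.FiniteIndex.index_ne_zero).trans_le hMh
  obtain ⟨f₂, -, rfl⟩ := mem_image.1 hg'
  rcases (univ.filter (fun f => cls f = g)).eq_empty_or_nonempty with hA | ⟨f₁, hf₁⟩
  · simp [hA]
  rw [mem_filter] at hf₁
  obtain ⟨w, hw, hwz⟩ :=
    exists_small_repr Λ hMh ((fun t => ((f₂ t : ℕ) : ℤ)) - (fun t => ((f₁ t : ℕ) : ℤ)))
  set A := univ.filter (fun f => cls f = g) with hAdef
  have hsplit := card_filter_add_card_filter_not (s := A) (fun f => ∀ t, (f t : ℕ) + (w t : ℕ) < M)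
  have h1 : (A.filter (fun f => ∀ t, (f t : ℕ) + (w t : ℕ) < M)).card ≤
      (univ.filter (fun f => cls f = cls f₂)).card := by
    apply card_le_card_of_injOn
      (fun (f : Fin T → Fin M) (t : Fin T) => (⟨((f t : ℕ) + (w t : ℕ)) % M, Nat.mod_lt _ hM⟩ : Fin M))
    · intro f hf
      rw [mem_coe, mem_filter, hAdef, mem_filter] at hf
      rw [mem_coe, mem_filter]
      refine ⟨mem_univ _, ?_⟩
      rw [hcls]
      have hfg : (fun t => ((f t : ℕ) : ℤ) - ((f₁ t : ℕ) : ℤ)) ∈ Λ := (hcls f f₁).1 (hf.1.2.trans hf₁.2.symm)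
      convert Λ.add_mem hfg hwz using 1
      funext t
      simp only [Pi.add_apply, Pi.sub_apply, Nat.mod_eq_of_lt (hf.2 t)]
      push_cast
      ring
    · intro f hf f' hf' hff
      rw [mem_coe, mem_filter] at hf hf'
      funext t
      have h := congrFun hff t
      simp only [Fin.mk.injEq, Nat.mod_eq_of_lt (hf.2 t), Nat.mod_eq_of_lt (hf'.2 t)] at h
      exact Fin.ext (by omega)
  have h2 : (A.filter (fun f => ¬ ∀ t, (f t : ℕ) + (w t : ℕ) < M)).card ≤ Λ.index * T * M ^ (T - 1) := by
    calc (A.filter (fun f => ¬ ∀ t, (f t : ℕ) + (w t : ℕ) < M)).card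
        ≤ (univ.biUnion (fun t : Fin T =>
            univ.filter (fun f : Fin T → Fin M => M ≤ (f t : ℕ) + (w t : ℕ)))).card := by
          apply card_le_card
          intro f hf
          simp only [mem_filter, not_forall, not_lt] at hf
          obtain ⟨t, ht⟩ := hf.2
          exact mem_biUnion.2 ⟨t, mem_univ _, mem_filter.2 ⟨mem_univ _, ht⟩⟩
      _ ≤ ∑ t : Fin T, (univ.filter (fun f : Fin T → Fin M => M ≤ (f t : ℕ) + (w t : ℕ))).card :=
          card_biUnion_le
      _ ≤ ∑ _t : Fin T, Λ.index * M ^ (T - 1) :=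
          sum_le_sum fun t _ => (card_filter_le_apply_add T M _ t).trans (Nat.mul_le_mul_right _ (hw t).le)
      _ = Λ.index * T * M ^ (T - 1) := by
          rw [sum_const, card_univ, Fintype.card_fin, smul_eq_mul]
          ring
  omega

/-! ### Transport to the register `[0, M^T)` -/

/-- The base-`M` digits of the number encoded by `finFunctionFinEquiv f` are the entries of `f`. [folklore] -/
theorem finFunctionFinEquiv_div_pow_mod {T M : ℕ} (f : Fin T → Fin M) (t : Fin T) :
    ((finFunctionFinEquiv f : Fin (M ^ T)) : ℕ) / M ^ (t : ℕ) % M = f t := by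
  have h := congrArg (fun g : Fin T → Fin M => (g t : ℕ))
    ((finFunctionFinEquiv : (Fin T → Fin M) ≃ Fin (M ^ T)).symm_apply_apply f)
  simpa only [finFunctionFinEquiv_symm_apply_val] using h

/-- The register `[0, M^T)` is the image of the box `[0, M)^T` under the base-`M` encoding. [folklore] -/
theorem range_pow_eq_image_finFunctionFinEquiv (T M : ℕ) :
    range (M ^ T) = univ.image (fun f : Fin T → Fin M => ((finFunctionFinEquiv f : Fin (M ^ T)) : ℕ)) := by
  ext E
  simp only [mem_range, mem_image, mem_univ, true_and]
  constructor
  · intro hE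
    exact ⟨(finFunctionFinEquiv : (Fin T → Fin M) ≃ Fin (M ^ T)).symm ⟨E, hE⟩, by simp⟩
  · rintro ⟨f, rfl⟩
    exact (finFunctionFinEquiv f).isLt

/-- The base-`M` encoding of the box is injective. [folklore] -/
theorem finFunctionFinEquiv_val_injective (T M : ℕ) :
    Function.Injective (fun f : Fin T → Fin M => ((finFunctionFinEquiv f : Fin (M ^ T)) : ℕ)) :=
  fun _ _ h => (finFunctionFinEquiv : (Fin T → Fin M) ≃ Fin (M ^ T)).injective (Fin.ext h)

/-- A class table of the register, read on the box: the hypothesis `cls E = cls E' ↔ d(E) − d(E') ∈ Λ` for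
`E, E' < M^T` becomes `cls ∘ enc` being a class table of the box. [folklore] -/
theorem cls_comp_finFunctionFinEquiv_iff {T M : ℕ} (Λ : AddSubgroup (Fin T → ℤ)) (cls : ℕ → ℕ)
    (hcls : ∀ E < M ^ T, ∀ E' < M ^ T, cls E = cls E' ↔
      (fun t : Fin T => ((E / M ^ (t : ℕ) % M : ℕ) : ℤ) - ((E' / M ^ (t : ℕ) % M : ℕ) : ℤ)) ∈ Λ)
    (f f' : Fin T → Fin M) :
    cls ((finFunctionFinEquiv f : Fin (M ^ T)) : ℕ) = cls ((finFunctionFinEquiv f' : Fin (M ^ T)) : ℕ) ↔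
      (fun t => ((f t : ℕ) : ℤ) - ((f' t : ℕ) : ℤ)) ∈ Λ := by
  have h := hcls _ (finFunctionFinEquiv f).isLt _ (finFunctionFinEquiv f').isLt
  simpa only [finFunctionFinEquiv_div_pow_mod] using h

/-! ### The register versions -/

/-- **The number of classes of a class table is the index.** For `0 < M`, a finite-index `Λ ≤ ℤ^T` with
`[ℤ^T : Λ] ≤ M`, and a labelling `cls` of `[0, M^T)` with `cls E = cls E' ↔ d(E) − d(E') ∈ Λ` (digit vectors
`d(E)_t = E / M^t mod M`), the labels used number exactly `[ℤ^T : Λ]`. [folklore] -/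
theorem card_image_cls_eq_index (T M : ℕ) (Λ : AddSubgroup (Fin T → ℤ)) [Λ.FiniteIndex]
    (hMh : Λ.index ≤ M) (cls : ℕ → ℕ)
    (hcls : ∀ E < M ^ T, ∀ E' < M ^ T, cls E = cls E' ↔
      (fun t : Fin T => ((E / M ^ (t : ℕ) % M : ℕ) : ℤ) - ((E' / M ^ (t : ℕ) % M : ℕ) : ℤ)) ∈ Λ) :
    ((range (M ^ T)).image cls).card = Λ.index := by
  rw [range_pow_eq_image_finFunctionFinEquiv, image_image]
  exact card_image_cls_eq_index_box Λ hMh _ (cls_comp_finFunctionFinEquiv_iff Λ cls hcls)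

/-- **Two classes of a class table differ in size by at most `[ℤ^T : Λ] T M^(T-1)`.** Same setting as
`card_image_cls_eq_index`; for any label `g` and any USED label `g'`,
`#{E < M^T : cls E = g} ≤ #{E < M^T : cls E = g'} + [ℤ^T : Λ] T M^(T-1)`. [folklore] -/
theorem card_class_le_card_class_add (T M : ℕ) (Λ : AddSubgroup (Fin T → ℤ)) [Λ.FiniteIndex]
    (hMh : Λ.index ≤ M) (cls : ℕ → ℕ)
    (hcls : ∀ E < M ^ T, ∀ E' < M ^ T, cls E = cls E' ↔
      (fun t : Fin T => ((E / M ^ (t : ℕ) % M : ℕ) : ℤ) - ((E' / M ^ (t : ℕ) % M : ℕ) : ℤ)) ∈ Λ)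
    (g g' : ℕ) (hg' : g' ∈ (range (M ^ T)).image cls) :
    ((range (M ^ T)).filter (fun E => cls E = g)).card ≤
      ((range (M ^ T)).filter (fun E => cls E = g')).card + Λ.index * T * M ^ (T - 1) := by
  rw [range_pow_eq_image_finFunctionFinEquiv, image_image] at hg'
  rw [range_pow_eq_image_finFunctionFinEquiv, filter_image, filter_image,
    card_image_of_injective _ (finFunctionFinEquiv_val_injective T M),
    card_image_of_injective _ (finFunctionFinEquiv_val_injective T M)]
  exact card_class_le_card_class_add_box Λ hMh _ (cls_comp_finFunctionFinEquiv_iff Λ cls hcls) g g' hg'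

/-- **Coset box counts** (the two register statements together, in the shape consumed by the class-table law):
exactly `[ℤ^T : Λ]` classes, and any two classes differ in size by at most `[ℤ^T : Λ] T M^(T-1)`. [folklore] -/
theorem cosetBoxCount (T M : ℕ) (Λ : AddSubgroup (Fin T → ℤ)) [Λ.FiniteIndex]
    (hMh : Λ.index ≤ M) (cls : ℕ → ℕ)
    (hcls : ∀ E < M ^ T, ∀ E' < M ^ T, cls E = cls E' ↔
      (fun t : Fin T => ((E / M ^ (t : ℕ) % M : ℕ) : ℤ) - ((E' / M ^ (t : ℕ) % M : ℕ) : ℤ)) ∈ Λ) :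
    ((range (M ^ T)).image cls).card = Λ.index ∧
      ∀ g ∈ (range (M ^ T)).image cls, ∀ g' ∈ (range (M ^ T)).image cls,
        ((range (M ^ T)).filter (fun E => cls E = g)).card ≤
          ((range (M ^ T)).filter (fun E => cls E = g')).card + Λ.index * T * M ^ (T - 1) :=
  ⟨card_image_cls_eq_index T M Λ hMh cls hcls,
    fun g _ g' hg' => card_class_le_card_class_add T M Λ hMh cls hcls g g' hg'⟩

end PeriodFinding

end Literature.Computability.Cryptography
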